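import Summits.QuantumFields.YangMills.Theorems.BalabanLadderROTKingLimitStabiliser
import Summits.QuantumFields.YangMills.Theorems.BalabanLadderROTKingLimitCyclotomic
import Literature.Analysis.FluidPDE.OctahedralSymmetry
import HarnessLib

/-!
# Crux `ROT` (stmt-QuantumFields-20042), stub `stub_kingLimit` — crystallographic exclusion of `C_{4m}` (1/3): the COMPOSITE ROTATION
# `R₀₁(π/(2m)) ≫ σ` is a conjugate `Q ∘ R₀₁(ω) ∘ Q⁻¹` with `2 cos ω = −1 − cos (π/(2m))`, hence of IRRATIONAL angle for `m ≥ 2`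

Helper file (`--supports stmt-QuantumFields-20042 --as helper`; seat `ymfull-r2d-prover-1`, R590-ym item (15)); part 1 of 3 of the
crystallographic exclusion (parts 2–3: `…CrystallographicCircles.lean`, `…Crystallographic.lean`), after ✓`…KingLimitStabiliser.lean`
(p783639: `KingLimit ⇔` no UV limit point has planar stabiliser `(π/(2m))ℤ`, `m ≥ 1`) and ✓`…KingLimitCyclotomic.lean` (p783996:
`cos (π/(2m)) ∉ ℤ̄`, `m ≥ 2`).  Line of record «King split», skeleton v4 (824d5540ff52cfd5), ONE registered stub `stub_kingLimit : KingLimit`;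
road-independent.  GOAL OF THE SERIES: a `W(B₄)`-invariant one-field family with bounded densities fixed by `R₀₁(π/(2m))`, `m ≥ 2`, is fixed
by EVERY `R₀₁(θ)` — so the residual of the registered stub is «no UV limit point has planar stabiliser EXACTLY `C₄`», i.e. KING at ANY one
non-lattice angle suffices.

THIS FILE (pure Euclidean geometry of `ℝ⁴` + the arithmetic of part 0; no Yang–Mills object):
* §0 coordinates: `inner_eq_sum4`, `norm_sq_eq_inner_sum4`, `inner_planeRot_self`
  (`⟪R_θ x, x⟫ = cos θ (x₀² + x₁²) + x₂² + x₃²`), and ★ `exists_planeRot_apply_eq` — TRANSITIVITY of the plane rotations on circles (two vectors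
  with equal `x₂, x₃, x₀² + x₁²` differ by some `R₀₁(a)`; angle from ✓`Mopup.exists_cos_eq_and_sin_eq`).
* §1 determinants of composites and conjugates of linear isometries (`det_trans`, `det_conj`).
* §2 the composite `G = R₀₁(α) ≫ σ`, `σ : x ↦ (x₂, −x₁, x₀, x₃)` (signed permutation; `det σ = 1` by a `4 × 4` determinant, `det_sigmaU`):
  it fixes `(sin α, 1 − cos α, sin α, 0)` (`composite_apply_axis`) and `e₃`, and `⟪G f, f⟫ = −(1 + cos α)` on `f = e₀ − e₂` (`inner_composite_test`).
* §3 ★ `exists_frame_of_unit` — every unit `v ⊥ e₃` is `Q e₂` for an isometry `Q` of determinant `1` fixing `e₃` (spherical coordinates: a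
  rotation of the `(x₀,x₂)`-plane as the conjugate of `planeRot 0 ψ` by the swap `x₁ ↔ x₂`, then `planeRot 0 φ`).
* §4 ★ `exists_conj_planeRot_eq_composite` — for `α = π/(2m)`, `m ≥ 2`: `G = Q ∘ R₀₁(ω) ∘ Q⁻¹` with `Q e₂ = n` the unit axis (`Q⁻¹ G Q` fixes
  `e₂, e₃` with determinant `1`, so it is a `planeRot 0 ω` by ✓`Mopup.exists_eq_planeRot`), `2 cos ω = ⟪G f, f⟫ = −1 − cos α` (for `f ⊥ n`,
  `⟪G f, f⟫ = ⟪R_ω Q⁻¹f, Q⁻¹f⟫ = 2 cos ω`), hence `ω/(2π) ∉ ℚ` (✓`irrational_div_pi_of_two_cos_eq_neg`): THE COMPOSITE HAS INFINITE ORDER.  Also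
  exported for part 2: `n₃ = 0`, `n₀ = n₂ ≥ 0`, `n₂² ≥ 1/3`.

0 sorry, standard axioms, no definition.  HONEST LABEL: structural; `KingLimit`, `ROT` and the Yang–Mills mass gap are NOT proved.

References: C. King, Commun. Math. Phys. 103 (1986) 323–349, Thm 2.4; I. Niven, Irrational Numbers (1956) Ch. III §3; H. S. M. Coxeter,
Regular Polytopes (1973) §3.7 (crystallographic restriction).
-/

set_option autoImplicit false

noncomputable section

open scoped SchwartzMap InnerProductSpace
open MeasureTheory Filter Topology
open Literature.MathematicalPhysics.QuantumFieldTheory Literature.MathematicalPhysics.QuantumLattice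
open Literature.MathematicalPhysics.AQFT Literature.Probability.LatticeModels
open Summit.QuantumFields.YangMills.Cruxes.OSLegsFromFemtoAndGap.DlrCollarTransfer
open Summit.QuantumFields.YangMills.Cruxes.OSLegsAtWeakCouplingC.Sketch
open Summit.QuantumFields.YangMills.Cruxes.OSLegsAtWeakCouplingC.Y2Bridge
open Summit.QuantumFields.YangMills.Theorems.NPointIsotropy.Negative (E4)
open Summit.QuantumFields.YangMills.Theorems.NPointIsotropy.ComplexRotationBandlimit.Mopup
  (exists_eq_planeRot exists_cos_eq_and_sin_eq)
open Summit.QuantumFields.YangMills.Theorems.CurvatureBoostCovariance.BoostsInheritMirrors.OrbitBandlimit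
  (planeRot_add_apply planeRot_symm_apply' det_planeRot)
open Literature.Analysis.FluidPDE (signedPermIsometry signedPermIsometry_apply isSignedPermIsometry_signedPermIsometry)

namespace Summit.QuantumFields.YangMills.Theorems.ROT.KingStabiliser


/-! ## §0 Coordinates on `ℝ⁴`: inner products, norms, the plane rotations -/

/-- The real inner product of `ℝ⁴` in coordinates. [folklore] -/
theorem inner_eq_sum4 (x y : E4) : ⟪x, y⟫_ℝ = x 0 * y 0 + x 1 * y 1 + x 2 * y 2 + x 3 * y 3 := by
  simp only [PiLp.inner_apply, Fin.sum_univ_four, RCLike.inner_apply, conj_trivial]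
  ring

/-- `⟪R_θ x, x⟫ = cos θ (x₀² + x₁²) + x₂² + x₃²`. [folklore] -/
theorem inner_planeRot_self (θ : ℝ) (x : E4) :
    ⟪planeRot (0 : Fin 3) θ x, x⟫_ℝ = Real.cos θ * (x 0 ^ 2 + x 1 ^ 2) + x 2 ^ 2 + x 3 ^ 2 := by
  have h0 : planeRot (0 : Fin 3) θ x 0 = Real.cos θ * x 0 + Real.sin θ * x 1 := by simp [planeRot_apply]
  have h1 : planeRot (0 : Fin 3) θ x 1 = -Real.sin θ * x 0 + Real.cos θ * x 1 := by simp [planeRot_apply]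
  have h2 : planeRot (0 : Fin 3) θ x 2 = x 2 := by simp [planeRot_apply]
  have h3 : planeRot (0 : Fin 3) θ x 3 = x 3 := by simp [planeRot_apply]
  rw [inner_eq_sum4, h0, h1, h2, h3]
  ring

/-- The squared norm is the self inner product (so `inner_eq_sum4` gives it in coordinates). [folklore] -/
theorem norm_sq_eq_inner_sum4 (x : E4) : ‖x‖ ^ 2 = ⟪x, x⟫_ℝ := (real_inner_self_eq_norm_sq x).symm

/-- **Transitivity of the plane rotations on circles**: two vectors of `ℝ⁴` with the same `x₂`, `x₃` and the same
`x₀² + x₁²` differ by a rotation of the `(x₀,x₁)`-plane. [folklore] -/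
theorem exists_planeRot_apply_eq {u w : E4} (h2 : u 2 = w 2) (h3 : u 3 = w 3)
    (hρ : u 0 ^ 2 + u 1 ^ 2 = w 0 ^ 2 + w 1 ^ 2) : ∃ a : ℝ, planeRot (0 : Fin 3) a u = w := by
  by_cases hρ0 : u 0 ^ 2 + u 1 ^ 2 = 0
  · -- degenerate circle: `u = w`
    have hu0 : u 0 = 0 := by nlinarith [sq_nonneg (u 0), sq_nonneg (u 1)]
    have hu1 : u 1 = 0 := by nlinarith [sq_nonneg (u 0), sq_nonneg (u 1)]
    have hw0 : w 0 = 0 := by nlinarith [sq_nonneg (w 0), sq_nonneg (w 1)]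
    have hw1 : w 1 = 0 := by nlinarith [sq_nonneg (w 0), sq_nonneg (w 1)]
    refine ⟨0, ?_⟩
    rw [planeRot_zero_apply]
    ext j
    fin_cases j
    · exact hu0.trans hw0.symm
    · exact hu1.trans hw1.symm
    · exact h2
    · exact h3
  · set ρ : ℝ := u 0 ^ 2 + u 1 ^ 2 with hρdef
    have hcs : ((u 0 * w 0 + u 1 * w 1) / ρ) ^ 2 + ((u 1 * w 0 - u 0 * w 1) / ρ) ^ 2 = 1 := by
      field_simp
      nlinarith [hρ]
    obtain ⟨a, hca, hsa⟩ := exists_cos_eq_and_sin_eq hcs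
    refine ⟨a, ?_⟩
    ext j
    fin_cases j
    · show Real.cos a * u 0 + Real.sin a * u 1 = w 0
      rw [hca, hsa]
      field_simp
      ring
    · show -Real.sin a * u 0 + Real.cos a * u 1 = w 1
      rw [hca, hsa]
      field_simp
      ring
    · exact h2
    · exact h3

/-! ## §1 Determinants of composites of linear isometries -/

/-- Determinant of a composite of linear isometries. [folklore] -/
theorem det_trans (A B : E4 ≃ₗᵢ[ℝ] E4) :
    LinearMap.det ((A.trans B).toLinearEquiv : E4 →ₗ[ℝ] E4) =
      LinearMap.det (B.toLinearEquiv : E4 →ₗ[ℝ] E4) * LinearMap.det (A.toLinearEquiv : E4 →ₗ[ℝ] E4) := by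
  have h : ((A.trans B).toLinearEquiv : E4 →ₗ[ℝ] E4) =
      (B.toLinearEquiv : E4 →ₗ[ℝ] E4) ∘ₗ (A.toLinearEquiv : E4 →ₗ[ℝ] E4) := by
    ext x
    rfl
  rw [h, LinearMap.det_comp]

/-- Determinant of a conjugate `P ∘ R ∘ P⁻¹` of linear isometries. [folklore] -/
theorem det_conj (P R : E4 ≃ₗᵢ[ℝ] E4) :
    LinearMap.det ((P.symm.trans (R.trans P)).toLinearEquiv : E4 →ₗ[ℝ] E4) =
      LinearMap.det (R.toLinearEquiv : E4 →ₗ[ℝ] E4) := by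
  have h : ((P.symm.trans (R.trans P)).toLinearEquiv : E4 →ₗ[ℝ] E4) =
      (P.toLinearEquiv : E4 →ₗ[ℝ] E4) ∘ₗ (R.toLinearEquiv : E4 →ₗ[ℝ] E4) ∘ₗ
        ((P.toLinearEquiv).symm : E4 →ₗ[ℝ] E4) := by
    ext x
    rfl
  rw [h, LinearMap.det_conj]


/-! ## §2 The composite `G = R₀₁(α) ≫ σ` (`σ : x ↦ (x₂, −x₁, x₀, x₃)`): its axis and its rotation angle -/

/-- The signed permutation `σ : (x₀,x₁,x₂,x₃) ↦ (x₂, −x₁, x₀, x₃)` (the half turn about `(e₀+e₂)/√2`) has determinant `1`.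
[folklore] -/
theorem det_sigmaU :
    LinearMap.det ((signedPermIsometry (Equiv.swap (0 : Fin 4) 2) (![1, -1, 1, 1] : Fin 4 → ℤˣ)).toLinearEquiv :
      E4 →ₗ[ℝ] E4) = 1 := by
  set R := signedPermIsometry (Equiv.swap (0 : Fin 4) 2) (![1, -1, 1, 1] : Fin 4 → ℤˣ) with hR
  set b := (EuclideanSpace.basisFun (Fin 4) ℝ).toBasis with hb
  have hM : LinearMap.toMatrix b b (R.toLinearEquiv : E4 →ₗ[ℝ] E4) =
      !![0, 0, 1, 0; 0, -1, 0, 0; 1, 0, 0, 0; 0, 0, 0, 1] := by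
    ext i j
    rw [LinearMap.toMatrix_apply, hb, OrthonormalBasis.coe_toBasis_repr_apply,
      EuclideanSpace.basisFun_repr, OrthonormalBasis.coe_toBasis, EuclideanSpace.basisFun_apply,
      LinearEquiv.coe_coe, LinearIsometryEquiv.coe_toLinearEquiv]
    fin_cases i <;> fin_cases j <;> simp [hR, signedPermIsometry_apply, Equiv.swap_apply_def]
  have h12 : Fin.succAbove (1 : Fin 4) (2 : Fin 3) = 3 := by decide
  have h22 : Fin.succAbove (2 : Fin 4) (2 : Fin 3) = 3 := by decide
  have h02 : Fin.succAbove (0 : Fin 4) (2 : Fin 3) = 3 := by decide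
  rw [← LinearMap.det_toMatrix b, hM]
  simp [Matrix.det_succ_row_zero, Fin.sum_univ_succ, h12, h22, h02]

/-- The composite `G = R₀₁(α) ≫ σ` has determinant `1`. [folklore] -/
theorem det_composite (α : ℝ) :
    LinearMap.det (((planeRot (0 : Fin 3) α).trans
      (signedPermIsometry (Equiv.swap (0 : Fin 4) 2) (![1, -1, 1, 1] : Fin 4 → ℤˣ))).toLinearEquiv : E4 →ₗ[ℝ] E4) = 1 := by
  rw [det_trans, det_sigmaU,
    det_planeRot, mul_one]

/-- **The axis of the composite**: `G = R₀₁(α) ≫ σ` fixes the vector `(sin α, 1 − cos α, sin α, 0)`. [folklore] -/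
theorem composite_apply_axis (α : ℝ) :
    ((planeRot (0 : Fin 3) α).trans (signedPermIsometry (Equiv.swap (0 : Fin 4) 2) (![1, -1, 1, 1] : Fin 4 → ℤˣ)))
      (!₂[Real.sin α, 1 - Real.cos α, Real.sin α, 0]) = !₂[Real.sin α, 1 - Real.cos α, Real.sin α, 0] := by
  have h := Real.sin_sq_add_cos_sq α
  ext j
  fin_cases j <;> simp [signedPermIsometry_apply, Equiv.swap_apply_def, planeRot_apply] <;> nlinarith [h]

/-- The composite fixes `e₃`. [folklore] -/
theorem composite_apply_single_three (α : ℝ) :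
    ((planeRot (0 : Fin 3) α).trans (signedPermIsometry (Equiv.swap (0 : Fin 4) 2) (![1, -1, 1, 1] : Fin 4 → ℤˣ)))
      (EuclideanSpace.single 3 1) = EuclideanSpace.single 3 1 := by
  ext j
  fin_cases j <;> simp [signedPermIsometry_apply, Equiv.swap_apply_def, planeRot_apply]

/-- **The trace datum of the composite**: on the test vector `f = e₀ − e₂` (orthogonal to the axis),
`⟪G f, f⟫ = −(1 + cos α)`. [folklore] -/
theorem inner_composite_test (α : ℝ) :
    ⟪((planeRot (0 : Fin 3) α).trans (signedPermIsometry (Equiv.swap (0 : Fin 4) 2) (![1, -1, 1, 1] : Fin 4 → ℤˣ)))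
        (!₂[(1 : ℝ), 0, -1, 0]), (!₂[(1 : ℝ), 0, -1, 0] : E4)⟫_ℝ = -(1 + Real.cos α) := by
  rw [inner_eq_sum4]
  simp [signedPermIsometry_apply, Equiv.swap_apply_def, planeRot_apply]
  ring

/-! ## §3 Frames: an isometry of determinant one carrying `e₂` to a given unit vector of `e₃^⊥` and fixing `e₃` -/

/-- **Frame lemma**: for every unit vector `v ⊥ e₃` of `ℝ⁴` there is a linear isometry `Q` of determinant `1` with `Q e₂ = v`
and `Q e₃ = e₃` — a rotation of the `(x₀,x₂)`-plane (a conjugate of `planeRot 0 ψ` by the coordinate swap `x₁ ↔ x₂`) followed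
by a rotation of the `(x₀,x₁)`-plane (spherical coordinates). [folklore] -/
theorem exists_frame_of_unit (v : E4) (hv : ‖v‖ = 1) (hv3 : v 3 = 0) :
    ∃ Q : E4 ≃ₗᵢ[ℝ] E4, Q (EuclideanSpace.single 2 1) = v ∧ Q (EuclideanSpace.single 3 1) = EuclideanSpace.single 3 1 ∧
      LinearMap.det (Q.toLinearEquiv : E4 →ₗ[ℝ] E4) = 1 := by
  -- spherical data: `cos ψ = v₂`, `sin ψ = ρ = √(v₀² + v₁²)`; `(cos φ, sin φ) = (v₀, −v₁)/ρ`
  have hsq : v 0 ^ 2 + v 1 ^ 2 + v 2 ^ 2 = 1 := by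
    have h : ‖v‖ ^ 2 = v 0 ^ 2 + v 1 ^ 2 + v 2 ^ 2 + v 3 ^ 2 := by
      rw [norm_sq_eq_inner_sum4, inner_eq_sum4]; ring
    rw [hv, hv3] at h
    nlinarith [h]
  set ρ : ℝ := Real.sqrt (v 0 ^ 2 + v 1 ^ 2) with hρ
  have hρ0 : 0 ≤ ρ := Real.sqrt_nonneg _
  have hρsq : ρ ^ 2 = v 0 ^ 2 + v 1 ^ 2 := Real.sq_sqrt (by positivity)
  obtain ⟨ψ, hcψ, hsψ⟩ := exists_cos_eq_and_sin_eq (a := v 2) (b := ρ) (by nlinarith [hρsq, hsq])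
  have hφ : ∃ φ : ℝ, Real.cos φ * ρ = v 0 ∧ -(Real.sin φ * ρ) = v 1 := by
    by_cases hρz : ρ = 0
    · have h0 : v 0 = 0 := by nlinarith [sq_nonneg (v 0), sq_nonneg (v 1), hρsq, hρz]
      have h1 : v 1 = 0 := by nlinarith [sq_nonneg (v 0), sq_nonneg (v 1), hρsq, hρz]
      exact ⟨0, by rw [hρz, h0, mul_zero], by rw [hρz, h1, mul_zero, neg_zero]⟩
    · obtain ⟨φ, hc, hs⟩ := exists_cos_eq_and_sin_eq (a := v 0 / ρ) (b := -(v 1 / ρ)) (by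
        field_simp; nlinarith [hρsq])
      exact ⟨φ, by rw [hc]; field_simp, by rw [hs]; field_simp⟩
  obtain ⟨φ, hφ0, hφ1⟩ := hφ
  let X : E4 ≃ₗᵢ[ℝ] E4 := signedPermIsometry (Equiv.swap (1 : Fin 4) 2) (1 : Fin 4 → ℤˣ)
  refine ⟨(X.symm.trans ((planeRot (0 : Fin 3) ψ).trans X)).trans (planeRot (0 : Fin 3) φ), ?_, ?_, ?_⟩
  · ext j
    fin_cases j <;>
      simp [X, signedPermIsometry_apply, Literature.Analysis.FluidPDE.signedPermIsometry_symm_apply,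
        Equiv.swap_apply_def, planeRot_apply, hcψ, hsψ]
    · linarith [hφ0]
    · linarith [hφ1]
    · exact hv3.symm
  · ext j
    fin_cases j <;>
      simp [X, signedPermIsometry_apply, Literature.Analysis.FluidPDE.signedPermIsometry_symm_apply,
        Equiv.swap_apply_def, planeRot_apply]
  · rw [det_trans, det_conj,
      det_planeRot,
      det_planeRot,
      mul_one]

/-! ## §4 The composite is a conjugate `Q ∘ R₀₁(ω) ∘ Q⁻¹` with `2 cos ω = −1 − cos α`, `ω/π` irrational for `α = π/(2m)`, `m ≥ 2` -/

/-- ★ **Structure of the composite.**  For `α = π/(2m)`, `m ≥ 2`, there are a linear isometry `Q` of determinant `1` fixing `e₃`,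
whose image `n = Q e₂` of `e₂` (the unit axis `∝ (sin α, 1 − cos α, sin α, 0)`) lies in `e₃^⊥` with `n₀ = n₂`, `n₂ ≥ 0`, `n₂² ≥ 1/3`,
and an angle `ω` with `G = Q ∘ R₀₁(ω) ∘ Q⁻¹` — so `G` is the rotation by `ω` about `n` — where `2 cos ω = −1 − cos α`, hence
`ω/(2π)` is IRRATIONAL (`irrational_div_pi_of_two_cos_eq_neg`: `cos (π/(2m))` is not an algebraic integer): the composite has
infinite order. [cite: Niven1956, Ch. III §3] -/
theorem exists_conj_planeRot_eq_composite {m : ℕ} (hm : 2 ≤ m) :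
    ∃ (Q : E4 ≃ₗᵢ[ℝ] E4) (ω : ℝ),
      Q (EuclideanSpace.single 3 1) = EuclideanSpace.single 3 1 ∧
      LinearMap.det (Q.toLinearEquiv : E4 →ₗ[ℝ] E4) = 1 ∧
      Q (EuclideanSpace.single 2 1) 3 = 0 ∧
      Q (EuclideanSpace.single 2 1) 0 = Q (EuclideanSpace.single 2 1) 2 ∧
      0 ≤ Q (EuclideanSpace.single 2 1) 2 ∧
      1 / 3 ≤ (Q (EuclideanSpace.single 2 1) 2) ^ 2 ∧
      (planeRot (0 : Fin 3) (Real.pi / (2 * m))).trans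
          (signedPermIsometry (Equiv.swap (0 : Fin 4) 2) (![1, -1, 1, 1] : Fin 4 → ℤˣ)) =
        Q.symm.trans ((planeRot (0 : Fin 3) ω).trans Q) ∧
      2 * Real.cos ω = -1 - Real.cos (Real.pi / (2 * m)) ∧
      Irrational (ω / (2 * Real.pi)) := by
  have inner_apply_eq_inner_symm : ∀ (R : E4 ≃ₗᵢ[ℝ] E4) (x y : E4), ⟪R x, y⟫_ℝ = ⟪x, R.symm y⟫_ℝ :=
    fun R x y => by rw [← R.inner_map_map x (R.symm y), LinearIsometryEquiv.apply_symm_apply]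
  set α : ℝ := Real.pi / (2 * m) with hα
  set G : E4 ≃ₗᵢ[ℝ] E4 := (planeRot (0 : Fin 3) α).trans
    (signedPermIsometry (Equiv.swap (0 : Fin 4) 2) (![1, -1, 1, 1] : Fin 4 → ℤˣ)) with hG
  -- the angle `α ∈ (0, π/2]`: `0 ≤ cos α < 1`, `0 ≤ sin α`
  have hm0 : (0 : ℝ) < m := by exact_mod_cast (show 0 < m by omega)
  have hαpos : 0 < α := by rw [hα]; positivity
  have hαle : α ≤ Real.pi / 2 := by
    rw [hα]
    have h2m : (2 : ℝ) ≤ 2 * m := by nlinarith [(show (2 : ℝ) ≤ m by exact_mod_cast hm)]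
    exact div_le_div_of_nonneg_left Real.pi_pos.le two_pos h2m
  have hαlt : α < Real.pi := by linarith [Real.pi_pos]
  have hcos1 : Real.cos α < 1 := by
    have h := Real.cos_lt_cos_of_nonneg_of_le_pi_div_two le_rfl hαle hαpos
    rwa [Real.cos_zero] at h
  have hcos0 : 0 ≤ Real.cos α := Real.cos_nonneg_of_mem_Icc ⟨by linarith, hαle⟩
  have hsin0 : 0 ≤ Real.sin α := Real.sin_nonneg_of_nonneg_of_le_pi hαpos.le hαlt.le
  have hcs := Real.sin_sq_add_cos_sq α
  -- the unit axis
  set N : ℝ := Real.sqrt (2 * Real.sin α ^ 2 + (1 - Real.cos α) ^ 2) with hN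
  have hN2 : N ^ 2 = 2 * Real.sin α ^ 2 + (1 - Real.cos α) ^ 2 := Real.sq_sqrt (by positivity)
  have hNpos : 0 < N := by
    rw [hN]
    apply Real.sqrt_pos.2
    nlinarith [sq_nonneg (Real.sin α)]
  set n : E4 := !₂[Real.sin α / N, (1 - Real.cos α) / N, Real.sin α / N, 0] with hn
  have hn_smul : n = N⁻¹ • (!₂[Real.sin α, 1 - Real.cos α, Real.sin α, 0] : E4) := by
    ext j
    fin_cases j <;> simp [hn, div_eq_inv_mul]
  have hn0 : n 0 = Real.sin α / N := by simp [hn]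
  have hn1 : n 1 = (1 - Real.cos α) / N := by simp [hn]
  have hn2 : n 2 = Real.sin α / N := by simp [hn]
  have hn3 : n 3 = 0 := by simp [hn]
  have hn_norm : ‖n‖ = 1 := by
    have h : ‖n‖ ^ 2 = 1 := by
      rw [norm_sq_eq_inner_sum4, inner_eq_sum4, hn0, hn1, hn2, hn3]
      field_simp
      rw [hN2]
      ring
    nlinarith [norm_nonneg n]
  obtain ⟨Q, hQ2, hQ3, hQdet⟩ := exists_frame_of_unit n hn_norm hn3
  -- `G` fixes `n` and `e₃`
  have hGn : G n = n := by
    rw [hn_smul, map_smul, hG, composite_apply_axis]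
  have hG3 : G (EuclideanSpace.single 3 1) = EuclideanSpace.single 3 1 := by
    rw [hG]; exact composite_apply_single_three α
  -- `M = Q⁻¹ G Q` fixes `e₂, e₃` and has determinant one: it is a plane rotation `R₀₁(ω)`
  set M : E4 ≃ₗᵢ[ℝ] E4 := Q.trans (G.trans Q.symm) with hM
  have hM2 : M (EuclideanSpace.single 2 1) = EuclideanSpace.single 2 1 := by
    simp only [hM, LinearIsometryEquiv.trans_apply, hQ2, hGn]
    rw [← hQ2, Q.symm_apply_apply]
  have hM3 : M (EuclideanSpace.single 3 1) = EuclideanSpace.single 3 1 := by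
    have h : Q.symm (G (Q (EuclideanSpace.single 3 1))) = Q.symm (Q (EuclideanSpace.single 3 1)) := by
      rw [hQ3, hG3]
    rw [Q.symm_apply_apply] at h
    simpa [hM] using h
  have hMdet : LinearMap.det (M.toLinearEquiv : E4 →ₗ[ℝ] E4) = 1 := by
    have h : M = Q.symm.symm.trans (G.trans Q.symm) := by rw [LinearIsometryEquiv.symm_symm]
    rw [h, det_conj, hG, det_composite]
  obtain ⟨ω, hω⟩ := exists_eq_planeRot M hMdet hM2 hM3
  have hGconj : G = Q.symm.trans ((planeRot (0 : Fin 3) ω).trans Q) := by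
    rw [← hω]
    refine LinearIsometryEquiv.ext fun x => ?_
    simp [hM]
  -- the angle: `2 cos ω = ⟪G f, f⟫ = −(1 + cos α)` on `f = e₀ − e₂ ⊥ n`
  have hcosω : 2 * Real.cos ω = -1 - Real.cos α := by
    set f : E4 := !₂[(1 : ℝ), 0, -1, 0] with hf
    have h1 : ⟪G f, f⟫_ℝ = -(1 + Real.cos α) := by rw [hG, hf]; exact inner_composite_test α
    set y : E4 := Q.symm f with hy
    have h2 : ⟪G f, f⟫_ℝ = ⟪planeRot (0 : Fin 3) ω y, y⟫_ℝ := by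
      rw [hGconj]
      simp only [LinearIsometryEquiv.trans_apply]
      rw [inner_apply_eq_inner_symm Q, hy]
    have hf0 : f 0 = 1 := by simp [hf]
    have hf1 : f 1 = 0 := by simp [hf]
    have hf2 : f 2 = -1 := by simp [hf]
    have hf3 : f 3 = 0 := by simp [hf]
    have hy2 : y 2 = 0 := by
      have h : ⟪y, EuclideanSpace.single 2 (1 : ℝ)⟫_ℝ = y 2 := by simp [EuclideanSpace.inner_single_right]
      rw [← h, hy, inner_apply_eq_inner_symm Q.symm, LinearIsometryEquiv.symm_symm, hQ2, inner_eq_sum4,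
        hf0, hf1, hf2, hf3, hn0, hn2]
      ring
    have hy3 : y 3 = 0 := by
      have h : ⟪y, EuclideanSpace.single 3 (1 : ℝ)⟫_ℝ = y 3 := by simp [EuclideanSpace.inner_single_right]
      rw [← h, hy, inner_apply_eq_inner_symm Q.symm, LinearIsometryEquiv.symm_symm, hQ3]
      simp [EuclideanSpace.inner_single_right, hf3]
    have hynorm : y 0 ^ 2 + y 1 ^ 2 = 2 := by
      have h : ‖y‖ ^ 2 = 2 := by
        rw [hy, LinearIsometryEquiv.norm_map, norm_sq_eq_inner_sum4, inner_eq_sum4, hf0, hf1, hf2, hf3]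
        norm_num
      rw [norm_sq_eq_inner_sum4, inner_eq_sum4, hy2, hy3] at h
      linarith
    have h3 : ⟪planeRot (0 : Fin 3) ω y, y⟫_ℝ = 2 * Real.cos ω := by
      rw [inner_planeRot_self, hynorm, hy2, hy3]
      ring
    linarith [h1, h2, h3]
  have hirr : Irrational (ω / (2 * Real.pi)) := by
    have h := irrational_div_pi_of_two_cos_eq_neg hm (by rw [← hα]; exact hcosω)
    rintro ⟨q, hq⟩
    refine h ⟨2 * q, ?_⟩
    push_cast
    rw [hq]
    field_simp
  refine ⟨Q, ω, hQ3, hQdet, ?_, ?_, ?_, ?_, hGconj, hcosω, hirr⟩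
  · rw [hQ2]; exact hn3
  · rw [hQ2, hn0, hn2]
  · rw [hQ2, hn2]; positivity
  · rw [hQ2, hn2, div_pow, le_div_iff₀ (by positivity), hN2]
    nlinarith [hcs, hcos0, hcos1]

end Summit.QuantumFields.YangMills.Theorems.ROT.KingStabiliser

end
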